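import Literature.Analysis.FluidPDE.TaoCascadeRescaledEnergy
import HarnessLib

/-!
# Tao's cascade ODE, §6.6: the five-mode equations (6.129)–(6.133) with explicit errors

T. Tao, *Finite time blowup for an averaged three-dimensional Navier–Stokes equation*,
J. Amer. Math. Soc. **29** (2016), 601–674 = arXiv:1402.0290v3, §6.6, the display (6.129)–(6.133):
"From (6.45)–(6.48), the energy bounds (6.92)–(6.94), and Proposition 6.13, we observe the
equations of motion `∂ₜa₀ = -ε⁻²c₀d₀ + O(K⁻⁹)`, `∂ₜb₀ = εa₀² - ε⁻¹K^{10}c₀² + O((1+ε₀)^{-n₀/2})`,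
`∂ₜc₀ = ε²exp(-K^{10})a₀² + ε⁻¹K^{10}b₀c₀ + O((1+ε₀)^{-n₀/2})`,
`∂ₜd₀ = ε⁻²c₀a₀ - (1+ε₀)^{5/2}Kd₀a₁ + O((1+ε₀)^{-n₀/2})`,
`∂ₜa₁ = (1+ε₀)^{5/2}Kd₀² + O(K⁻¹|a₁|) + O(K^{-20})` for these modes in the time interval
`0 ≤ t ≤ T₂`."

Here they are derived **pointwise in time** from the hypotheses `RescaledHypotheses γ …` of
Prop. 6.5 (`TaoCascadeRescaled.lean`; modes `a_k, b_k, c_k, d_k ↦ Xr 0 k, …, Xr 3 k`, energies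
`Ẽ_k ↦ Er k`) and *pointwise* bounds standing in for the bootstrap regime — `Ẽ₀(t) ≤ 1`,
`Ẽ₋₁(t) ≤ Em`, `Ẽ₁(t) ≤ 1` and bounds `|b₁(t)| ≤ B_b`, `|c₁(t)| ≤ B_c`, `|d₁(t)| ≤ B_d` on the
scale-`1` secondary modes (the outputs of Prop. 6.13) — with every implied constant explicit and
in the exact shapes consumed by the stand-alone estimates of `TaoCascadeZeroScale*.lean`
(`ρ = (ε²)⁻¹`, `μ = ε⁻¹K^{10}`, `λ = ε² e^{-K^{10}}`, `κ = (1+ε₀)^{5/2}K`).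

## References

* T. Tao, J. Amer. Math. Soc. 29 (2016), 601–674, arXiv:1402.0290v3, §6.4 (6.45)–(6.48), §6.6
  (6.129)–(6.133). [`Tao2016AveragedNS`]
-/

noncomputable section

open Set MeasureTheory

namespace Literature.Analysis.FluidPDE

namespace TaoCascade

section FiveModes

variable {γ ε₀ K ε C₁ C₂ C₃ : ℝ} {n₀ N : ℤ} {τ : ℤ → ℝ} {Xr : Fin 4 → ℤ → ℝ → ℝ} {Er : ℤ → ℝ → ℝ}

/-- Products of two modes of the same scale are bounded by twice the energy:
`|Xr_i Xr_j| ≤ 2 Ẽ_k` (from (6.51)). [cite: Tao2016AveragedNS, §6.4 Prop. 6.5 (iv)] -/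
theorem RescaledHypotheses.abs_mul_le_two_mul_energy
    (h : RescaledHypotheses γ ε₀ K ε C₁ C₂ C₃ n₀ N τ Xr Er) (i j : Fin 4) (k : ℤ) {t : ℝ}
    (ht : τ (n₀ - N) ≤ t) : |Xr i k t * Xr j k t| ≤ 2 * Er k t := by
  have hi := h.sq_le_two_mul_energy i k ht
  have hj := h.sq_le_two_mul_energy j k ht
  rw [abs_mul]
  nlinarith [sq_abs (Xr i k t), sq_abs (Xr j k t), sq_nonneg (|Xr i k t| - |Xr j k t|),
    abs_nonneg (Xr i k t), abs_nonneg (Xr j k t)]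

/-- **(6.129) with explicit error.** At a time `t ≥ τ_{n₀-N}` with `Ẽ₀(t) ≤ 1` and `Ẽ₋₁(t) ≤ Em`,
`|∂ₜa₀ + ε⁻²c₀d₀| ≤ 2ε + 2ε²e^{-K^{10}} + 2K Em + C₁(1+ε₀)^{-n₀/2}` (`ε ≥ 0`, `K ≥ 0`, `C₁ ≥ 0`).
[cite: Tao2016AveragedNS, §6.6 (6.129)] -/
theorem RescaledHypotheses.eq_a_zero
    (h : RescaledHypotheses γ ε₀ K ε C₁ C₂ C₃ n₀ N τ Xr Er) (hε : 0 ≤ ε) (hK : 0 ≤ K) (hC₁ : 0 ≤ C₁)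
    (hε₀ : -1 < ε₀) {t Em : ℝ} (ht : τ (n₀ - N) ≤ t) (hE0 : Er 0 t ≤ 1) (hEm : Er (-1) t ≤ Em) :
    |derivWithin (Xr 0 0) (Ici (τ (n₀ - N))) t + (ε ^ 2)⁻¹ * Xr 2 0 t * Xr 3 0 t| ≤
      2 * ε + 2 * ε ^ 2 * Real.exp (-K ^ 10) + 2 * K * Em + C₁ * (1 + ε₀) ^ (-((n₀ : ℝ) / 2)) := by
  have h1 := h.eq1 0 t ht
  simp only [Int.cast_zero, mul_zero, zero_div, Real.rpow_zero, one_mul, zero_sub] at h1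
  have hab := h.abs_mul_le_two_mul_energy 0 1 0 ht
  have hac := h.abs_mul_le_two_mul_energy 0 2 0 ht
  have hdd := h.sq_le_two_mul_energy 3 (-1) ht
  have hsq : Real.sqrt (Er 0 t) ≤ 1 := by
    rw [Real.sqrt_le_left zero_le_one]; simpa using hE0
  have hw : 0 ≤ C₁ * (1 + ε₀) ^ (-((n₀ : ℝ) / 2)) :=
    mul_nonneg hC₁ (Real.rpow_nonneg (by linarith) _)
  have key : derivWithin (Xr 0 0) (Ici (τ (n₀ - N))) t + (ε ^ 2)⁻¹ * Xr 2 0 t * Xr 3 0 t =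
      (derivWithin (Xr 0 0) (Ici (τ (n₀ - N))) t -
        (-(ε ^ 2)⁻¹ * Xr 2 0 t * Xr 3 0 t - ε * Xr 0 0 t * Xr 1 0 t -
          ε ^ 2 * Real.exp (-K ^ 10) * Xr 0 0 t * Xr 2 0 t + K * Xr 3 (-1) t ^ 2)) +
      (-(ε * (Xr 0 0 t * Xr 1 0 t)) - ε ^ 2 * Real.exp (-K ^ 10) * (Xr 0 0 t * Xr 2 0 t) +
        K * Xr 3 (-1) t ^ 2) := by ring
  rw [key]
  refine (abs_add_le _ _).trans ?_
  have t0 : |derivWithin (Xr 0 0) (Ici (τ (n₀ - N))) t -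
      (-(ε ^ 2)⁻¹ * Xr 2 0 t * Xr 3 0 t - ε * Xr 0 0 t * Xr 1 0 t -
        ε ^ 2 * Real.exp (-K ^ 10) * Xr 0 0 t * Xr 2 0 t + K * Xr 3 (-1) t ^ 2)| ≤
      C₁ * (1 + ε₀) ^ (-((n₀ : ℝ) / 2)) := by
    refine h1.trans ?_
    calc C₁ * (1 + ε₀) ^ (-((n₀ : ℝ) / 2)) * Real.sqrt (Er 0 t) ≤
        C₁ * (1 + ε₀) ^ (-((n₀ : ℝ) / 2)) * 1 := mul_le_mul_of_nonneg_left hsq hw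
      _ = _ := mul_one _
  have t1 : |-(ε * (Xr 0 0 t * Xr 1 0 t))| ≤ 2 * ε := by
    rw [abs_neg, abs_mul, abs_of_nonneg hε]; nlinarith
  have t2 : |ε ^ 2 * Real.exp (-K ^ 10) * (Xr 0 0 t * Xr 2 0 t)| ≤ 2 * ε ^ 2 * Real.exp (-K ^ 10) := by
    rw [abs_mul, abs_of_nonneg (by positivity)]
    have : 0 ≤ ε ^ 2 * Real.exp (-K ^ 10) := by positivity
    nlinarith
  have t3 : |K * Xr 3 (-1) t ^ 2| ≤ 2 * K * Em := by
    rw [abs_mul, abs_of_nonneg hK, abs_of_nonneg (sq_nonneg _)]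
    nlinarith
  have hs1 := abs_add_le (-(ε * (Xr 0 0 t * Xr 1 0 t)) - ε ^ 2 * Real.exp (-K ^ 10) * (Xr 0 0 t * Xr 2 0 t))
    (K * Xr 3 (-1) t ^ 2)
  have hs2 := abs_sub (-(ε * (Xr 0 0 t * Xr 1 0 t))) (ε ^ 2 * Real.exp (-K ^ 10) * (Xr 0 0 t * Xr 2 0 t))
  linarith

/-- **(6.130) with explicit error**: `|∂ₜb₀ - (εa₀² - ε⁻¹K^{10}c₀²)| ≤ C₁(1+ε₀)^{-n₀/2}` when
`Ẽ₀(t) ≤ 1`. [cite: Tao2016AveragedNS, §6.6 (6.130)] -/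
theorem RescaledHypotheses.eq_b_zero
    (h : RescaledHypotheses γ ε₀ K ε C₁ C₂ C₃ n₀ N τ Xr Er) (hC₁ : 0 ≤ C₁) (hε₀ : -1 < ε₀)
    {t : ℝ} (ht : τ (n₀ - N) ≤ t) (hE0 : Er 0 t ≤ 1) :
    |derivWithin (Xr 1 0) (Ici (τ (n₀ - N))) t - (ε * Xr 0 0 t ^ 2 - ε⁻¹ * K ^ 10 * Xr 2 0 t ^ 2)| ≤
      C₁ * (1 + ε₀) ^ (-((n₀ : ℝ) / 2)) := by
  have h2 := h.eq2 0 t ht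
  simp only [Int.cast_zero, mul_zero, zero_div, Real.rpow_zero, one_mul, zero_sub] at h2
  have hsq : Real.sqrt (Er 0 t) ≤ 1 := by
    rw [Real.sqrt_le_left zero_le_one]; simpa using hE0
  have hw : 0 ≤ C₁ * (1 + ε₀) ^ (-((n₀ : ℝ) / 2)) :=
    mul_nonneg hC₁ (Real.rpow_nonneg (by linarith) _)
  refine h2.trans ?_
  calc C₁ * (1 + ε₀) ^ (-((n₀ : ℝ) / 2)) * Real.sqrt (Er 0 t) ≤
      C₁ * (1 + ε₀) ^ (-((n₀ : ℝ) / 2)) * 1 := mul_le_mul_of_nonneg_left hsq hw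
    _ = _ := mul_one _

/-- **(6.131) with explicit error**: `|∂ₜc₀ - (ε²e^{-K^{10}}a₀² + ε⁻¹K^{10}b₀c₀)| ≤ C₁(1+ε₀)^{-n₀/2}`
when `Ẽ₀(t) ≤ 1`. [cite: Tao2016AveragedNS, §6.6 (6.131)] -/
theorem RescaledHypotheses.eq_c_zero
    (h : RescaledHypotheses γ ε₀ K ε C₁ C₂ C₃ n₀ N τ Xr Er) (hC₁ : 0 ≤ C₁) (hε₀ : -1 < ε₀)
    {t : ℝ} (ht : τ (n₀ - N) ≤ t) (hE0 : Er 0 t ≤ 1) :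
    |derivWithin (Xr 2 0) (Ici (τ (n₀ - N))) t -
        (ε ^ 2 * Real.exp (-K ^ 10) * Xr 0 0 t ^ 2 + ε⁻¹ * K ^ 10 * Xr 1 0 t * Xr 2 0 t)| ≤
      C₁ * (1 + ε₀) ^ (-((n₀ : ℝ) / 2)) := by
  have h3 := h.eq3 0 t ht
  simp only [Int.cast_zero, mul_zero, zero_div, Real.rpow_zero, one_mul, zero_sub] at h3
  have hsq : Real.sqrt (Er 0 t) ≤ 1 := by
    rw [Real.sqrt_le_left zero_le_one]; simpa using hE0
  have hw : 0 ≤ C₁ * (1 + ε₀) ^ (-((n₀ : ℝ) / 2)) :=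
    mul_nonneg hC₁ (Real.rpow_nonneg (by linarith) _)
  refine h3.trans ?_
  calc C₁ * (1 + ε₀) ^ (-((n₀ : ℝ) / 2)) * Real.sqrt (Er 0 t) ≤
      C₁ * (1 + ε₀) ^ (-((n₀ : ℝ) / 2)) * 1 := mul_le_mul_of_nonneg_left hsq hw
    _ = _ := mul_one _

/-- **(6.132) with explicit error**: `|∂ₜd₀ - (ε⁻²c₀a₀ - (1+ε₀)^{5/2}Kd₀a₁)| ≤ C₁(1+ε₀)^{-n₀/2}`
when `Ẽ₀(t) ≤ 1`. [cite: Tao2016AveragedNS, §6.6 (6.132)] -/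
theorem RescaledHypotheses.eq_d_zero
    (h : RescaledHypotheses γ ε₀ K ε C₁ C₂ C₃ n₀ N τ Xr Er) (hC₁ : 0 ≤ C₁) (hε₀ : -1 < ε₀)
    {t : ℝ} (ht : τ (n₀ - N) ≤ t) (hE0 : Er 0 t ≤ 1) :
    |derivWithin (Xr 3 0) (Ici (τ (n₀ - N))) t -
        ((ε ^ 2)⁻¹ * Xr 2 0 t * Xr 0 0 t - (1 + ε₀) ^ ((5 : ℝ) / 2) * K * Xr 3 0 t * Xr 0 1 t)| ≤
      C₁ * (1 + ε₀) ^ (-((n₀ : ℝ) / 2)) := by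
  have h4 := h.eq4 0 t ht
  simp only [Int.cast_zero, mul_zero, zero_div, Real.rpow_zero, one_mul, zero_sub, zero_add] at h4
  have hsq : Real.sqrt (Er 0 t) ≤ 1 := by
    rw [Real.sqrt_le_left zero_le_one]; simpa using hE0
  have hw : 0 ≤ C₁ * (1 + ε₀) ^ (-((n₀ : ℝ) / 2)) :=
    mul_nonneg hC₁ (Real.rpow_nonneg (by linarith) _)
  refine h4.trans ?_
  calc C₁ * (1 + ε₀) ^ (-((n₀ : ℝ) / 2)) * Real.sqrt (Er 0 t) ≤
      C₁ * (1 + ε₀) ^ (-((n₀ : ℝ) / 2)) * 1 := mul_le_mul_of_nonneg_left hsq hw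
    _ = _ := mul_one _

/-- **(6.133) with explicit error.** At a time `t ≥ τ_{n₀-N}` with `Ẽ₁(t) ≤ 1` and bounds
`|b₁(t)| ≤ B_b`, `|c₁(t)| ≤ B_c`, `|d₁(t)| ≤ B_d` (`ε > 0`):
`|∂ₜa₁ - (1+ε₀)^{5/2}K d₀²| ≤ (1+ε₀)^{5/2}(εB_b + ε²e^{-K^{10}}B_c)·|a₁| +
(1+ε₀)^{5/2}ε⁻²B_cB_d + C₁(1+ε₀)^{2-n₀/2}` ("`O(K⁻¹|a₁|) + O(K^{-20})`").
[cite: Tao2016AveragedNS, §6.6 (6.133)] -/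
theorem RescaledHypotheses.eq_a_one
    (h : RescaledHypotheses γ ε₀ K ε C₁ C₂ C₃ n₀ N τ Xr Er) (hε : 0 < ε) (hC₁ : 0 ≤ C₁)
    (hε₀ : -1 < ε₀) {t Bb Bc Bd : ℝ} (ht : τ (n₀ - N) ≤ t) (hE1 : Er 1 t ≤ 1)
    (hb : |Xr 1 1 t| ≤ Bb) (hc : |Xr 2 1 t| ≤ Bc) (hd : |Xr 3 1 t| ≤ Bd) :
    |derivWithin (Xr 0 1) (Ici (τ (n₀ - N))) t - (1 + ε₀) ^ ((5 : ℝ) / 2) * K * Xr 3 0 t ^ 2| ≤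
      (1 + ε₀) ^ ((5 : ℝ) / 2) * (ε * Bb + ε ^ 2 * Real.exp (-K ^ 10) * Bc) * |Xr 0 1 t| +
        ((1 + ε₀) ^ ((5 : ℝ) / 2) * (ε ^ 2)⁻¹ * Bc * Bd + C₁ * (1 + ε₀) ^ (2 - (n₀ : ℝ) / 2)) := by
  have h5 := h.eq1 1 t ht
  simp only [Int.cast_one, mul_one, sub_self] at h5
  have hq : 0 < (1 + ε₀) ^ ((5 : ℝ) / 2) := Real.rpow_pos_of_pos (by linarith) _
  have hsq : Real.sqrt (Er 1 t) ≤ 1 := by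
    rw [Real.sqrt_le_left zero_le_one]; simpa using hE1
  have hw : 0 ≤ C₁ * (1 + ε₀) ^ (2 - (n₀ : ℝ) / 2) :=
    mul_nonneg hC₁ (Real.rpow_nonneg (by linarith) _)
  have hBb : 0 ≤ Bb := (abs_nonneg _).trans hb
  have hBc : 0 ≤ Bc := (abs_nonneg _).trans hc
  have hBd : 0 ≤ Bd := (abs_nonneg _).trans hd
  set Q := (1 + ε₀) ^ ((5 : ℝ) / 2) with hQ
  have key : derivWithin (Xr 0 1) (Ici (τ (n₀ - N))) t - Q * K * Xr 3 0 t ^ 2 =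
      (derivWithin (Xr 0 1) (Ici (τ (n₀ - N))) t -
        Q * (-(ε ^ 2)⁻¹ * Xr 2 1 t * Xr 3 1 t - ε * Xr 0 1 t * Xr 1 1 t -
          ε ^ 2 * Real.exp (-K ^ 10) * Xr 0 1 t * Xr 2 1 t + K * Xr 3 0 t ^ 2)) +
      Q * (-((ε ^ 2)⁻¹ * (Xr 2 1 t * Xr 3 1 t)) -
        (ε * Xr 1 1 t + ε ^ 2 * Real.exp (-K ^ 10) * Xr 2 1 t) * Xr 0 1 t) := by ring
  rw [key]
  refine (abs_add_le _ _).trans ?_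
  have t0 : |derivWithin (Xr 0 1) (Ici (τ (n₀ - N))) t -
      Q * (-(ε ^ 2)⁻¹ * Xr 2 1 t * Xr 3 1 t - ε * Xr 0 1 t * Xr 1 1 t -
        ε ^ 2 * Real.exp (-K ^ 10) * Xr 0 1 t * Xr 2 1 t + K * Xr 3 0 t ^ 2)| ≤
      C₁ * (1 + ε₀) ^ (2 - (n₀ : ℝ) / 2) := by
    refine h5.trans ?_
    calc C₁ * (1 + ε₀) ^ (2 - (n₀ : ℝ) / 2) * Real.sqrt (Er 1 t) ≤
        C₁ * (1 + ε₀) ^ (2 - (n₀ : ℝ) / 2) * 1 := mul_le_mul_of_nonneg_left hsq hw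
      _ = _ := mul_one _
  -- the secondary-mode terms
  have hcd : |Xr 2 1 t * Xr 3 1 t| ≤ Bc * Bd := by
    rw [abs_mul]; exact mul_le_mul hc hd (abs_nonneg _) hBc
  have hlam : 0 ≤ ε ^ 2 * Real.exp (-K ^ 10) := by positivity
  have hrate : |ε * Xr 1 1 t + ε ^ 2 * Real.exp (-K ^ 10) * Xr 2 1 t| ≤
      ε * Bb + ε ^ 2 * Real.exp (-K ^ 10) * Bc := by
    refine (abs_add_le _ _).trans ?_
    have u1 : |ε * Xr 1 1 t| ≤ ε * Bb := by
      rw [abs_mul, abs_of_pos hε]; exact mul_le_mul_of_nonneg_left hb hε.le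
    have u2 : |ε ^ 2 * Real.exp (-K ^ 10) * Xr 2 1 t| ≤ ε ^ 2 * Real.exp (-K ^ 10) * Bc := by
      rw [abs_mul, abs_of_nonneg hlam]; exact mul_le_mul_of_nonneg_left hc hlam
    linarith
  have t1 : |Q * (-((ε ^ 2)⁻¹ * (Xr 2 1 t * Xr 3 1 t)) -
      (ε * Xr 1 1 t + ε ^ 2 * Real.exp (-K ^ 10) * Xr 2 1 t) * Xr 0 1 t)| ≤
      Q * ((ε ^ 2)⁻¹ * (Bc * Bd) + (ε * Bb + ε ^ 2 * Real.exp (-K ^ 10) * Bc) * |Xr 0 1 t|) := by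
    rw [abs_mul, abs_of_pos hq]
    apply mul_le_mul_of_nonneg_left _ hq.le
    refine (abs_sub _ _).trans ?_
    rw [abs_neg, abs_mul, abs_of_pos (by positivity : (0 : ℝ) < (ε ^ 2)⁻¹),
      abs_mul (ε * Xr 1 1 t + ε ^ 2 * Real.exp (-K ^ 10) * Xr 2 1 t)]
    exact add_le_add (mul_le_mul_of_nonneg_left hcd (by positivity))
      (mul_le_mul_of_nonneg_right hrate (abs_nonneg _))
  have : Q * ((ε ^ 2)⁻¹ * (Bc * Bd) + (ε * Bb + ε ^ 2 * Real.exp (-K ^ 10) * Bc) * |Xr 0 1 t|) =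
      Q * (ε * Bb + ε ^ 2 * Real.exp (-K ^ 10) * Bc) * |Xr 0 1 t| + Q * (ε ^ 2)⁻¹ * Bc * Bd := by
    ring
  linarith

/-- **The energy inequality (6.49) at scale `0` with the input term bounded**: when
`Ẽ₋₁(t) ≤ Em` and `Ẽ₀(t) ≤ 1`,
`∂ₜẼ₀ ≤ -(1+ε₀)^{5/2}K d₀² a₁ + 2√2 K Em` (`K ≥ 0`). [cite: Tao2016AveragedNS, §6.4 (6.49)] -/
theorem RescaledHypotheses.energy_zero_deriv_le
    (h : RescaledHypotheses γ ε₀ K ε C₁ C₂ C₃ n₀ N τ Xr Er) (hK : 0 ≤ K) {t Em : ℝ}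
    (ht : τ (n₀ - N) ≤ t) (hE0 : Er 0 t ≤ 1) (hEm : Er (-1) t ≤ Em) :
    derivWithin (Er 0) (Ici (τ (n₀ - N))) t ≤
      -((1 + ε₀) ^ ((5 : ℝ) / 2) * K * Xr 3 0 t ^ 2 * Xr 0 1 t) + 2 * Real.sqrt 2 * K * Em := by
  have hen := h.energy 0 t ht
  simp only [Int.cast_zero, mul_zero, zero_div, Real.rpow_zero, mul_one, zero_sub, zero_add] at hen
  have hdd := h.sq_le_two_mul_energy 3 (-1) ht
  have ha : |Xr 0 0 t| ≤ Real.sqrt 2 := by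
    refine (h.abs_le_sqrt_energy 0 0 ht).trans (Real.sqrt_le_sqrt (by linarith))
  have hEm0 : 0 ≤ Em := le_trans (by nlinarith [sq_nonneg (Xr 3 (-1) t)]) hEm
  have t1 : K * (Xr 3 (-1) t ^ 2 * Xr 0 0 t) ≤ 2 * Real.sqrt 2 * K * Em := by
    have h1 : Xr 3 (-1) t ^ 2 * Xr 0 0 t ≤ Xr 3 (-1) t ^ 2 * |Xr 0 0 t| :=
      mul_le_mul_of_nonneg_left (le_abs_self _) (sq_nonneg _)
    have h2 : Xr 3 (-1) t ^ 2 * |Xr 0 0 t| ≤ (2 * Em) * Real.sqrt 2 :=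
      mul_le_mul (hdd.trans (by linarith)) ha (abs_nonneg _) (by positivity)
    nlinarith
  calc derivWithin (Er 0) (Ici (τ (n₀ - N))) t
      ≤ K * (Xr 3 (-1) t ^ 2 * Xr 0 0 t - (1 + ε₀) ^ ((5 : ℝ) / 2) * Xr 3 0 t ^ 2 * Xr 0 1 t) := hen
    _ = K * (Xr 3 (-1) t ^ 2 * Xr 0 0 t) - (1 + ε₀) ^ ((5 : ℝ) / 2) * K * Xr 3 0 t ^ 2 * Xr 0 1 t := by
        ring
    _ ≤ _ := by linarith

end FiveModes

end TaoCascade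

end Literature.Analysis.FluidPDE
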